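import Literature.Probability.RandomPlanarGeometry.HexSAWStripBridgeRenewal
import HarnessLib

/-!
# The pointwise threshold law `β_{T,m}(x_c) · y_T^m = O(1)`: contact-sliced renewal bounds for the horizontal bridges of the
# honeycomb strip and the coefficient-level transfer through the bridge decomposition

Topic `Literature/Probability/RandomPlanarGeometry` (continues `HexSAWStripBridgeRenewal.lean`).  Lane «pcv-sawmu», a-p2 g16,
`NEXT-TARGETS.md` (the pointwise threshold law).  EDITION 2 = edition 1 code verbatim, module header rewritten (referee token PW-1).  Sources of the SETTING: H. Duminil-Copin, A. Hammond, CMP 324 (2013) §2.2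
(renewal structure of bridges); E. Seneta, *Non-negative matrices* (1973), §6.1–§6.2 (sub-invariant vectors); N. R. Beaton et al.,
CMP 326 (2014) §4 and Corollary 8 (`y_T`).  The results are the lane's own.

## What is proved (namespace `Literature.Probability.RandomPlanarGeometry.SAW.HV`)

* §1 Contact-sliced classes `Uset`/`Mset` with sums `Ucs T N n j a b y` (all standard horizontal bridges with `≤ n+1 ≤ N+1` vertices,
  levels `a → b`, exactly `j` contacts off the start vertex, weight `x_c^{|h|−1} y^j`) and `Mcs T N j a b y` (the irreducible ones);
  the matrices `UcM`, `McM` on the `2T` levels; ★ the sliced split inequality `UcM_succ_le`: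
  `U^{(n+1)}_j ≤ M_j + Σ_{i ≤ j} M_i U^{(n)}_{j−i}`.
* §2 ★★ `exists_UcM_le` — for `y ∈ [1, y_T)`, with `s(y)` a sub-invariant vector of the limit matrix `I(y)` (`Σ_i M_i(y) ≤ I(y)`,
  `I(y) s ≤ s`, tree lemma `nonnegMat_exists_subInvariant_vector`) and `z = Σ_k M_0^k s` (the contact-free runs; `s + M_0 z = z`,
  `z ≤ K₁ s` with `K₁` uniform in `y` by the irreducibility ratio bound): `U_0 s ≤ z − s` and `U_j s ≤ K₁ s` for `j ≥ 1`, by induction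
  on the length bound; hence `U^{(n)}_j(a,b)(y) ≤ K` uniformly; letting `y ↑ y_T`: ★★★ `exists_Ucs_stripYT_le`.
* §3 `stripBcoeffY_eq_sum_bridgeLists` (coefficient-level bridge-list representation of `β_{T,L,m}`), the slices `hbSlice` of the
  horizontal-bridge series and ★ `exists_hbSlice_stripYT_le`.
* §4 `topCnt_eq_decTriple` (the contacts split over the three pieces of `HexSAWStripBridgeDecomposition.decTriple`), the SLICED
  case-A bound `sum_caseA_slice_le`, the mirror on slices `sum_caseB_slice_le`, `stripBcoeffY_mul_pow_le`
  (`β_{T,L,m} y_T^m ≤ 2 F₁ K₂ F₃(y_T)`), and ★★★★ `stripBcoeff_mul_pow_stripYT_le (hT : 2 ≤ T) : ∃ C, ∀ m, β_{T,m} y_T^m ≤ C` —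
  THE POINTWISE THRESHOLD LAW (k = 1) for every width `T ≥ 2`.  Own results of the lane; the cited sources give the setting.
* §5 width one coefficientwise (`stripBcoeffY_one_le`, `stripBcoeff_one_mul_pow_le`) and ★★★★ the law for every `T ≥ 1`:
  `stripBcoeff_mul_pow_stripYT_le_of_one_le`.
-/

noncomputable section

open Finset Filter Topology Matrix Literature.Probability.LatticeModels Literature.Probability.Percolation Literature.Analysis.Matrix

namespace Literature.Probability.RandomPlanarGeometry.SAW

namespace HV

/-! ### §1 Contact-sliced classes and the sliced split inequality -/

section Sliced

variable {T : ℕ}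

/-- Standard horizontal bridges `a → b` with at most `n + 1` (and `N + 1`) vertices and exactly `j` contacts off the start vertex
(plumbing). [folklore] -/
def Uset (T N n j : ℕ) (a b : ℤ) : Finset (List HV) :=
  (HBab T N a b).filter fun l => topCnt T l.tail = j ∧ l.length ≤ n + 1

/-- Irreducible standard horizontal bridges `a → b` (at most `N + 1` vertices) with exactly `j` contacts off the start vertex
(plumbing). [folklore] -/
def Mset (T N j : ℕ) (a b : ℤ) : Finset (List HV) := (HBk T N 1 a b).filter fun l => topCnt T l.tail = j

/-- `U^{(n)}_j(a,b)(y) = Σ x_c^{|h|−1} y^j` over `Uset` (plumbing). [folklore] -/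
def Ucs (T N n j : ℕ) (a b : ℤ) (y : ℝ) : ℝ := ∑ l ∈ Uset T N n j a b, wD T y l

/-- `M_j(a,b)(y) = Σ x_c^{|h|−1} y^j` over `Mset` (plumbing). [folklore] -/
def Mcs (T N j : ℕ) (a b : ℤ) (y : ℝ) : ℝ := ∑ l ∈ Mset T N j a b, wD T y l

/-- The sliced matrices on the `2T` levels (plumbing). [folklore] -/
def UcM (T N n j : ℕ) (y : ℝ) : Matrix (Fin (2 * T)) (Fin (2 * T)) ℝ := fun a b => Ucs T N n j (a : ℕ) (b : ℕ) y

/-- The sliced irreducible matrices `M_j(y)` on the `2T` levels (plumbing). [folklore] -/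
def McM (T N j : ℕ) (y : ℝ) : Matrix (Fin (2 * T)) (Fin (2 * T)) ℝ := fun a b => Mcs T N j (a : ℕ) (b : ℕ) y

variable {N n j : ℕ} {y : ℝ}

/-- Non-negativity of the sliced sums. [cite: DuminilCopinHammond2013, §2.2 (bridges of the strip); lane plumbing] -/
theorem Ucs_Mcs_nonneg (hy : 0 ≤ y) (a b : ℤ) : 0 ≤ Ucs T N n j a b y ∧ 0 ≤ Mcs T N j a b y :=
  ⟨sum_nonneg fun l _ => wD_nonneg T hy l, sum_nonneg fun l _ => wD_nonneg T hy l⟩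

/-- Contacts off the start vertex split additively at a renewal split. [cite: DuminilCopinHammond2013, §2.2] -/
theorem topCnt_tail_split {l : List HV} (h : (renIdxs l).Nonempty) :
    topCnt T l.tail = topCnt T (fstP l).tail + topCnt T (sndP l).tail := by
  obtain ⟨hne1, -⟩ := fstP_sndP_ne_nil h
  conv_lhs => rw [← fstP_append_tail_sndP l]
  rw [List.tail_append_of_ne_nil hne1, topCnt_append]

/-- `xstd` keeps the contacts off the start vertex. [cite: DuminilCopinHammond2013, §2.2 (bridges of the strip); lane plumbing] -/
theorem topCnt_tail_xstd (l : List HV) : topCnt T (xstd l).tail = topCnt T l.tail := by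
  rw [xstd, ← List.map_tail, topCnt_map_shift]

/-- The slices `M_i`, `i < J`, are disjoint parts of `I_N`: `Σ_{i<J} M_i(y) ≤ I_N(y)` entrywise (`y ≥ 0`).
[cite: DuminilCopinHammond2013, §2.2] -/
theorem sum_McM_le_Imat (hy : 0 ≤ y) (J : ℕ) (a b : Fin (2 * T)) :
    (∑ i ∈ range J, McM T N i y) a b ≤ Imat T N y a b := by
  classical
  rw [Matrix.sum_apply]
  simp only [McM, Mcs, Imat, Dk]
  have hdisj : Set.PairwiseDisjoint (range J : Set ℕ) fun i => Mset T N i (a : ℕ) (b : ℕ) := by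
    intro i _ i' _ hne
    rw [Function.onFun, disjoint_left]
    intro l h1 h2
    rw [Mset, mem_filter] at h1 h2
    exact hne (h1.2.symm.trans h2.2)
  rw [← sum_biUnion hdisj]
  refine sum_le_sum_of_subset_of_nonneg (fun l hl => ?_) fun _ _ _ => wD_nonneg T hy _
  rw [mem_biUnion] at hl
  obtain ⟨i, -, hi⟩ := hl
  exact (mem_filter.1 hi).1

/-- The slices grow with the length bound and are all contained in the full classes. [cite: DuminilCopinHammond2013, §2.2 (bridges of the strip); lane plumbing] -/
theorem Uset_mono {n' : ℕ} (h : n ≤ n') (j : ℕ) (a b : ℤ) : Uset T N n j a b ⊆ Uset T N n' j a b := by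
  intro l hl
  rw [Uset, mem_filter] at hl ⊢
  exact ⟨hl.1, hl.2.1, by omega⟩

set_option maxHeartbeats 400000 in
/-- ★ **The sliced split inequality**: a bridge with `≤ n+2` vertices and `j` contacts is irreducible, or an irreducible bridge with
`i ≤ j` contacts followed by a bridge with `≤ n+1` vertices and `j − i` contacts (injectively, weights multiply):
`U^{(n+1)}_j(a,b) ≤ M_j(a,b) + Σ_c Σ_{i ≤ j} M_i(a,c) U^{(n)}_{j−i}(c,b)`. [cite: DuminilCopinHammond2013, §2.2 (decomposition at the first renewal point)] -/
theorem UcM_succ_le (hy : 0 ≤ y) (a b : Fin (2 * T)) :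
    UcM T N (n + 1) j y a b ≤ McM T N j y a b + (∑ i ∈ range (j + 1), McM T N i y * UcM T N n (j - i) y) a b := by
  classical
  set S := Uset T N (n + 1) j (a : ℕ) (b : ℕ) with hS
  set Sirr := S.filter fun l => renIdxs l = ∅ with hSirr
  set Sred := S.filter fun l => renIdxs l ≠ ∅ with hSred
  have hmemS : ∀ l ∈ S, l.IsChain hvGraph.Adj ∧ l.Nodup ∧ l.length ≤ N + 1 ∧ (∃ v, l.head? = some v ∧ v.1 = 0) ∧ InLev T l ∧
      IsHBridge l ∧ 2 ≤ l.length ∧ hdLev l = a ∧ ltLev l = b ∧ topCnt T l.tail = j ∧ l.length ≤ n + 2 := by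
    intro l hl
    rw [hS, Uset, mem_filter, HBab, mem_filter, mem_hBridgesN_iff] at hl
    obtain ⟨⟨⟨hc, hnd, hlen, hh, hin, hB⟩, h2, ha, hb⟩, hj, hn⟩ := hl
    exact ⟨hc, hnd, hlen, hh, hin, hB, h2, ha, hb, hj, by omega⟩
  -- (1) the irreducible part
  have hirr : ∑ l ∈ Sirr, wD T y l ≤ McM T N j y a b := by
    rw [McM, Mcs]
    refine sum_le_sum_of_subset_of_nonneg (fun l hl => ?_) fun _ _ _ => wD_nonneg T hy _
    rw [hSirr, mem_filter] at hl
    obtain ⟨hl, hren⟩ := hl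
    obtain ⟨hc, hnd, hlen, hh, hin, hB, h2, ha, hb, hj, -⟩ := hmemS l hl
    rw [Mset, mem_filter, HBk, mem_filter]
    exact ⟨⟨mem_hBridgesN_iff.2 ⟨hc, hnd, hlen, hh, hin, hB⟩, h2, by rw [npieces, hren]; rfl, ha, hb⟩, hj⟩
  -- (2) the reducible part: the split map into the double union
  set tgt : Finset (List HV × List HV) := (Finset.univ : Finset (Fin (2 * T))).biUnion fun c =>
    (range (j + 1)).biUnion fun i => Mset T N i (a : ℕ) (c : ℕ) ×ˢ Uset T N n (j - i) (c : ℕ) (b : ℕ) with htgt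
  have himg : ∀ l ∈ Sred, (fstP l, xstd (sndP l)) ∈ tgt := by
    intro l hl
    rw [hSred, mem_filter] at hl
    obtain ⟨hl, hren'⟩ := hl
    have hren : (renIdxs l).Nonempty := Finset.nonempty_iff_ne_empty.2 hren'
    obtain ⟨hc, hnd, hlen, ⟨v, hv, hv0⟩, hin, hB, h2, ha, hb, hj, hn⟩ := hmemS l hl
    have hlens := length_fstP_sndP hren
    obtain ⟨hB1, hB2⟩ := isHBridge_fstP_sndP hB hren
    obtain ⟨e1, e2, e3, e4⟩ := fstP_sndP_ends hren
    obtain ⟨hne1, hne2⟩ := fstP_sndP_ne_nil hren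
    have hl0 : l ≠ [] := by rintro rfl; simp at h2
    have hsplit := topCnt_tail_split (T := T) hren
    set cz : ℤ := lev (l[fIdx l]'(by have := (fIdx_spec hren).1.2.1; omega)) with hcz
    have hcz0 : 0 ≤ cz ∧ cz ≤ 2 * (T : ℤ) - 1 := hin _ (List.getElem_mem _)
    let c : Fin (2 * T) := ⟨cz.toNat, by omega⟩
    have hcc : ((c : ℕ) : ℤ) = cz := by simp [c]; omega
    rw [htgt, mem_biUnion]
    refine ⟨c, mem_univ _, ?_⟩
    rw [mem_biUnion]
    refine ⟨topCnt T (fstP l).tail, mem_range.2 (by omega), mem_product.2 ⟨?_, ?_⟩⟩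
    · show fstP l ∈ Mset T N _ _ _
      rw [Mset, mem_filter, HBk, mem_filter, mem_hBridgesN_iff]
      refine ⟨⟨⟨hc.take _, hnd.sublist (List.take_sublist _ _), by omega, ⟨v, ?_, hv0⟩,
        fun w hw => hin w ((List.take_sublist _ _).subset hw), hB1⟩, by omega, by rw [npieces, renIdxs_fstP hren]; rfl, ?_, ?_⟩, rfl⟩
      · rw [fstP, List.head?_take, if_neg (by omega), hv]
      · rw [hdLev, fstP, List.head?_take, if_neg (by omega)]; rw [hdLev] at ha; exact ha
      · rw [ltLev, List.getLast?_eq_some_getLast hne1, Option.getD_some, e2, hcc]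
    · show xstd (sndP l) ∈ Uset T N n _ _ _
      rw [Uset, mem_filter, HBab, mem_filter, mem_hBridgesN_iff]
      have hv2 : (sndP l).head? = some (l[fIdx l]'(by have := (fIdx_spec hren).1.2.1; omega)) := by
        rw [List.head?_eq_some_head hne2, e3]
      refine ⟨⟨⟨isChain_xstd (hc.drop _), nodup_xstd (hnd.sublist (List.drop_sublist _ _)), by rw [length_xstd]; omega,
        ⟨_, head?_xstd hv2, rfl⟩, inLev_xstd fun w hw => hin w ((List.drop_sublist _ _).subset hw), isHBridge_xstd hB2⟩,
        by rw [length_xstd]; omega, ?_, ?_⟩, ?_, by rw [length_xstd]; have := (fIdx_spec hren).1.1; omega⟩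
      · rw [hdLev, head?_xstd hv2, Option.getD_some, hcc, hcz]; simp [lev, bit]
      · rw [ltLev, xstd, List.getLast?_map, List.getLast?_eq_some_getLast hne2, Option.map_some, Option.getD_some, lev_shift_zero, e4]
        rw [ltLev, List.getLast?_eq_some_getLast hl0, Option.getD_some] at hb; exact hb
      · rw [topCnt_tail_xstd]; omega
  have hinj : Set.InjOn (fun l : List HV => (fstP l, xstd (sndP l))) (Sred : Set (List HV)) := by
    intro l hl l' hl' h
    rw [mem_coe, hSred, mem_filter] at hl hl'
    exact split_injOn (Finset.nonempty_iff_ne_empty.2 hl.2) (Finset.nonempty_iff_ne_empty.2 hl'.2) h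
  have hred : ∑ l ∈ Sred, wD T y l ≤ (∑ i ∈ range (j + 1), McM T N i y * UcM T N n (j - i) y) a b := by
    calc ∑ l ∈ Sred, wD T y l = ∑ l ∈ Sred, wD T y (fstP l) * wD T y (xstd (sndP l)) := by
          refine sum_congr rfl fun l hl => ?_
          rw [hSred, mem_filter] at hl
          rw [wD_eq_mul_fstP_sndP T y (Finset.nonempty_iff_ne_empty.2 hl.2)]
          congr 1
          rw [wD, wD, length_xstd, topCnt_tail_xstd]
      _ = ∑ pq ∈ Sred.image fun l => (fstP l, xstd (sndP l)), wD T y pq.1 * wD T y pq.2 := by rw [sum_image hinj]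
      _ ≤ ∑ pq ∈ tgt, wD T y pq.1 * wD T y pq.2 := by
          refine sum_le_sum_of_subset_of_nonneg (fun pq hpq => ?_) fun pq _ _ => mul_nonneg (wD_nonneg T hy _) (wD_nonneg T hy _)
          rw [mem_image] at hpq
          obtain ⟨l, hl, rfl⟩ := hpq
          exact himg l hl
      _ = (∑ i ∈ range (j + 1), McM T N i y * UcM T N n (j - i) y) a b := by
          rw [Matrix.sum_apply, htgt, sum_biUnion]
          · -- Σ_c Σ_i Σ_{product} = Σ_i Σ_c (M_i)(a,c) U(c,b)
            have inner : ∀ c : Fin (2 * T), ∑ pq ∈ (range (j + 1)).biUnion (fun i =>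
                Mset T N i (a : ℕ) (c : ℕ) ×ˢ Uset T N n (j - i) (c : ℕ) (b : ℕ)), wD T y pq.1 * wD T y pq.2 =
                ∑ i ∈ range (j + 1), Mcs T N i (a : ℕ) (c : ℕ) y * Ucs T N n (j - i) (c : ℕ) (b : ℕ) y := by
              intro c
              rw [sum_biUnion]
              · refine sum_congr rfl fun i _ => ?_
                rw [sum_product, Mcs, Ucs, sum_mul_sum]
              · intro i _ i' _ hne
                rw [Function.onFun, disjoint_left]
                intro pq h1 h2
                rw [mem_product, Mset, mem_filter] at h1 h2
                exact hne (h1.1.2.symm.trans h2.1.2)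
            simp_rw [inner]
            rw [sum_comm]
            refine sum_congr rfl fun i _ => ?_
            rw [Matrix.mul_apply]; rfl
          · intro c _ c' _ hcc'
            rw [Function.onFun, disjoint_left]
            intro pq h1 h2
            rw [mem_biUnion] at h1 h2
            obtain ⟨i, -, h1⟩ := h1
            obtain ⟨i', -, h2⟩ := h2
            rw [mem_product, Mset, mem_filter, HBk, mem_filter] at h1 h2
            have e1 := h1.1.1.2.2.2.2; have e2 := h2.1.1.2.2.2.2
            exact hcc' (Fin.ext (by have := e1.symm.trans e2; exact_mod_cast this))
  -- assemble
  have hsplitS : ∑ l ∈ S, wD T y l = ∑ l ∈ Sirr, wD T y l + ∑ l ∈ Sred, wD T y l := by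
    rw [hSirr, hSred, ← sum_filter_add_sum_filter_not S (fun l => renIdxs l = ∅)]
  calc UcM T N (n + 1) j y a b = ∑ l ∈ S, wD T y l := rfl
    _ ≤ _ := by rw [hsplitS]; exact add_le_add hirr hred

/-- No bridge has fewer than two vertices: `U^{(0)} = 0`. [cite: DuminilCopinHammond2013, §2.2 (bridges of the strip); lane plumbing] -/
theorem UcM_zero (y : ℝ) (a b : Fin (2 * T)) : UcM T N 0 j y a b = 0 := by
  rw [UcM, Ucs]
  refine sum_eq_zero fun l hl => ?_
  rw [Uset, mem_filter, HBab, mem_filter] at hl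
  omega

end Sliced

/-! ### §2 The sub-invariant vector, the contact-free runs, and the uniform bound -/

section Analytic

variable {T N : ℕ} {y : ℝ}

/-- Iterating `A s ≤ s` for `A ≥ 0`: `A^k s ≤ s`. [cite: Seneta1973, §6.2 (sub-invariant vectors)] -/
theorem pow_mulVec_le_of_mulVec_le {ι : Type*} [Fintype ι] [DecidableEq ι] {A : Matrix ι ι ℝ} (hA : ∀ a b, 0 ≤ A a b)
    {s : ι → ℝ} (hs : A *ᵥ s ≤ s) (k : ℕ) : (A ^ k) *ᵥ s ≤ s := by
  induction k with
  | zero => simp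
  | succ k ih =>
    rw [pow_succ', ← Matrix.mulVec_mulVec]
    exact (nonnegMat_mulVec_le_mulVec_of_le hA ih).trans hs

/-- On the contact-free slice the weight does not depend on `y`: `M_0(y) = M_0(y')`. [cite: DuminilCopinHammond2013, §2.2 (bridges of the strip); lane plumbing] -/
theorem McM_zero_eq (y y' : ℝ) : McM T N 0 y = McM T N 0 y' := by
  ext a b
  simp only [McM, Mcs]
  refine sum_congr rfl fun l hl => ?_
  rw [Mset, mem_filter] at hl
  rw [wD, wD, hl.2, pow_zero, pow_zero]

/-- `M_i(y) ≤ I_N(y) ≤ I(y)` entrywise for `y ∈ [1, y_T)`. [cite: DuminilCopinHammond2013, §2.2] -/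
theorem sum_McM_le_Iinf (hT : 1 ≤ T) (hy : y ∈ Set.Ico 1 (stripYT T)) (J : ℕ) (a b : Fin (2 * T)) :
    (∑ i ∈ range J, McM T N i y) a b ≤ Iinf T y a b :=
  (sum_McM_le_Imat (sub_threshold_of_mem_Ico hT hy).2.1 J a b).trans (Imat_le_Iinf hT hy N a b)

/-- `M_i(y) ≥ 0` entrywise (`y ≥ 0`). [cite: DuminilCopinHammond2013, §2.2 (bridges of the strip); lane plumbing] -/
theorem McM_nonneg (hy : 0 ≤ y) (i : ℕ) (a b : Fin (2 * T)) : 0 ≤ McM T N i y a b :=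
  (Ucs_Mcs_nonneg (T := T) (N := N) (n := 0) (j := i) hy _ _).2

/-- `U ≥ 0` entrywise (`y ≥ 0`). [cite: DuminilCopinHammond2013, §2.2 (bridges of the strip); lane plumbing] -/
theorem UcM_nonneg (hy : 0 ≤ y) (n j : ℕ) (a b : Fin (2 * T)) : 0 ≤ UcM T N n j y a b :=
  (Ucs_Mcs_nonneg (T := T) (N := N) (n := n) (j := j) hy _ _).1

/-- Powers of `I(y)` are summable entrywise below the threshold. [cite: BeatonBousquetMelouDeGierDuminilCopinGuttmann2014, Corollary 8; Seneta1973, §6.1] -/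
theorem summable_pow_Iinf (hT : 1 ≤ T) (hy : y ∈ Set.Ico 1 (stripYT T)) (a b : Fin (2 * T)) :
    Summable fun k => (Iinf T y ^ k) a b := by
  obtain ⟨B, hB⟩ := exists_partialSum_pow_Iinf_le hT hy
  refine summable_of_sum_range_le (fun k => nonnegMat_pow_apply_nonneg (Iinf_nonneg hT hy) k a b) (c := B) fun n => ?_
  rw [← Matrix.sum_apply]; exact hB n a b

set_option maxHeartbeats 400000 in
/-- ★★ **The uniform bound on the contact slices below the threshold**: there is `K` with `U^{(n)}_j(a,b)(y) ≤ K` for all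
`y ∈ [1, y_T)`, `N`, `n`, `j`, `a`, `b`.  Proof: take a sub-invariant vector `s(y)` of `I(y)` (`nonnegMat_exists_subInvariant_vector`),
the contact-free runs `Z = Σ_k M_0^k` (summable since `M_0 ≤ I(1)`), `z = Z s` (`s + M_0 z = z`, `z ≤ K₁ s` uniformly by the
irreducibility ratio bound); then by induction on `n`: `U^{(n)}_0 s ≤ z − s` and `U^{(n)}_j s ≤ K₁ s` (`j ≥ 1`).
[cite: Seneta1973, §6.1 Theorem 6.1 and §6.2 Theorem 6.3; DuminilCopinHammond2013, §2.2; lane (NEXT-TARGETS: pointwise law)] -/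
theorem exists_UcM_le (hT : 1 ≤ T) :
    ∃ K : ℝ, ∀ y ∈ Set.Ico (1 : ℝ) (stripYT T), ∀ N n j (a b : Fin (2 * T)), UcM T N n j y a b ≤ K := by
  classical
  have h1T := one_lt_stripYT hT
  have h1mem : (1 : ℝ) ∈ Set.Ico (1 : ℝ) (stripYT T) := ⟨le_rfl, h1T⟩
  -- uniform data at `y = 1`: the resolvent bound `C₁` and the irreducibility witnesses
  obtain ⟨C, hC⟩ := exists_partialSum_pow_Iinf_le_div hT
  set C₁ := C / (stripYT T - 1) with hC₁
  have hW : ∀ a b : Fin (2 * T), ∑' k, (Iinf T 1 ^ k) a b ≤ C₁ := fun a b =>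
    Real.tsum_le_of_sum_range_le (fun k => nonnegMat_pow_apply_nonneg (Iinf_nonneg hT h1mem) k a b) fun n => by
      rw [← Matrix.sum_apply]; exact hC 1 h1mem n a b
  have hC₁0 : 0 ≤ C₁ := le_trans (tsum_nonneg fun k => nonnegMat_pow_apply_nonneg (Iinf_nonneg hT h1mem) k ⟨0, by omega⟩ ⟨0, by omega⟩)
    (hW _ _)
  -- irreducibility witnesses at `y = 1` (from `I_2(1) ≤ I(1)`)
  have hwit : ∀ ab : Fin (2 * T) × Fin (2 * T), ∃ j : ℕ, 0 < (Iinf T 1 ^ j) ab.1 ab.2 := by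
    intro ab
    obtain ⟨j, hj⟩ := reach_Imat_all hT (N := 2) le_rfl ab.1 ab.2
    exact ⟨j, hj.trans_le (nonnegMat_pow_apply_mono (fun a b => (Imat_Dmat_nonneg (N := 2) (k := 1) zero_le_one a b).1)
      (fun a b => Imat_le_Iinf hT h1mem 2 a b) j ab.1 ab.2)⟩
  choose jw hjw using hwit
  set Kr : ℝ := ∑ ab : Fin (2 * T) × Fin (2 * T), 1 / (Iinf T 1 ^ jw ab) ab.1 ab.2 with hKr
  have hKr_ge : ∀ a b : Fin (2 * T), 1 / (Iinf T 1 ^ jw (a, b)) a b ≤ Kr := fun a b =>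
    single_le_sum (f := fun ab : Fin (2 * T) × Fin (2 * T) => 1 / (Iinf T 1 ^ jw ab) ab.1 ab.2)
      (fun ab _ => (one_div_pos.2 (hjw ab)).le) (mem_univ (a, b))
  have hKr0 : 0 ≤ Kr := sum_nonneg fun ab _ => (one_div_pos.2 (hjw ab)).le
  set F : ℝ := (Fintype.card (Fin (2 * T)) : ℝ) with hF
  set K₁ : ℝ := F * C₁ * Kr + 1 with hK₁
  refine ⟨K₁ * Kr, fun y hy N n j a b => ?_⟩
  have hy0 : 0 ≤ y := (sub_threshold_of_mem_Ico hT hy).2.1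
  have hy1 : 1 ≤ y := hy.1
  -- the sub-invariant vector at `y`
  have hA := Iinf_nonneg hT hy
  obtain ⟨s, hs1, hAs, -⟩ := nonnegMat_exists_subInvariant_vector hA (summable_pow_Iinf hT hy)
  have hs0 : 0 ≤ s := fun a => zero_le_one.trans (hs1 a)
  have hspos : ∀ a, 0 < s a := fun a => zero_lt_one.trans_le (hs1 a)
  -- ratio bound: `s b ≤ Kr · s a`
  have hratio : ∀ a b, s b ≤ Kr * s a := by
    intro a b
    have hmono : (Iinf T 1 ^ jw (a, b)) a b ≤ (Iinf T y ^ jw (a, b)) a b :=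
      nonnegMat_pow_apply_mono (Iinf_nonneg hT h1mem)
        (fun a b => ciSup_le fun N => (Imat_mono_y zero_le_one hy1 a b).trans (Imat_le_Iinf hT hy N a b)) _ a b
    have h1 : (Iinf T y ^ jw (a, b)) a b * s b ≤ s a :=
      (nonnegMat_apply_mul_le_mulVec (nonnegMat_pow_apply_nonneg hA _) hs0 a b).trans (pow_mulVec_le_of_mulVec_le hA hAs _ a)
    have hw := hjw (a, b)
    have h2 : (Iinf T 1 ^ jw (a, b)) a b * s b ≤ s a := (mul_le_mul_of_nonneg_right hmono (hs0 b)).trans h1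
    calc s b = (1 / (Iinf T 1 ^ jw (a, b)) a b) * ((Iinf T 1 ^ jw (a, b)) a b * s b) := by field_simp
      _ ≤ (1 / (Iinf T 1 ^ jw (a, b)) a b) * s a := mul_le_mul_of_nonneg_left h2 (one_div_pos.2 hw).le
      _ ≤ Kr * s a := mul_le_mul_of_nonneg_right (hKr_ge a b) (hs0 a)
  -- the contact-free runs
  set M0 := McM T N 0 y with hM0
  have hM00 : ∀ a b, 0 ≤ M0 a b := fun a b => McM_nonneg hy0 0 a b
  have hM0le1 : ∀ a b, M0 a b ≤ Iinf T 1 a b := by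
    intro a b
    rw [hM0, McM_zero_eq y 1]
    have := sum_McM_le_Iinf (N := N) hT h1mem 1 a b
    rwa [sum_range_one] at this
  have hM0leA : ∀ a b, M0 a b ≤ Iinf T y a b := by
    intro a b
    have := sum_McM_le_Iinf (N := N) hT hy 1 a b
    rwa [sum_range_one] at this
  have hsumM0 : ∀ a b, Summable fun k => (M0 ^ k) a b := fun a b =>
    (summable_pow_Iinf hT h1mem a b).of_nonneg_of_le (fun k => nonnegMat_pow_apply_nonneg hM00 k a b)
      fun k => nonnegMat_pow_apply_mono hM00 hM0le1 k a b
  set Zm : Matrix (Fin (2 * T)) (Fin (2 * T)) ℝ := fun a b => ∑' k, (M0 ^ k) a b with hZm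
  have hZm_le : ∀ a b, Zm a b ≤ C₁ := fun a b =>
    (Summable.tsum_le_tsum (fun k => nonnegMat_pow_apply_mono hM00 hM0le1 k a b) (hsumM0 a b) (summable_pow_Iinf hT h1mem a b)).trans
      (hW a b)
  have hZm0 : ∀ a b, 0 ≤ Zm a b := fun a b => tsum_nonneg fun k => nonnegMat_pow_apply_nonneg hM00 k a b
  set z : Fin (2 * T) → ℝ := Zm *ᵥ s with hz
  -- `s + M0 z = z`
  have hz_eq : ∀ a, s a + (M0 *ᵥ z) a = z a := by
    intro a
    have hshift : ∀ b, ∑' k, (M0 ^ (k + 1)) a b = Zm a b - (M0 ^ 0) a b := fun b => by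
      simp only [hZm]; rw [(hsumM0 a b).tsum_eq_zero_add]; ring
    have e1 : (M0 *ᵥ z) a = ∑ b, (∑' k, (M0 ^ (k + 1)) a b) * s b := by
      simp only [hz, Matrix.mulVec, dotProduct]
      calc ∑ c, M0 a c * ∑ b, Zm c b * s b = ∑ c, ∑ b, M0 a c * Zm c b * s b := by
            simp_rw [Finset.mul_sum]; exact sum_congr rfl fun c _ => sum_congr rfl fun b _ => by ring
        _ = ∑ b, (∑ c, M0 a c * Zm c b) * s b := by
            rw [Finset.sum_comm]; exact sum_congr rfl fun b _ => by rw [Finset.sum_mul]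
        _ = ∑ b, (∑' k, (M0 ^ (k + 1)) a b) * s b := by
            refine sum_congr rfl fun b _ => ?_
            congr 1
            simp only [hZm]
            simp_rw [← tsum_mul_left]
            rw [← Summable.tsum_finsetSum fun c _ => (hsumM0 c b).mul_left (M0 a c)]
            refine tsum_congr fun k => ?_
            rw [pow_succ', Matrix.mul_apply]
    rw [e1]
    simp only [hz, Matrix.mulVec, dotProduct]
    simp_rw [hshift, sub_mul, Finset.sum_sub_distrib, pow_zero]
    simp [Matrix.one_apply]
  -- `z ≤ K₁ s`
  have hz_le : ∀ a, z a ≤ K₁ * s a := by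
    intro a
    simp only [hz, Matrix.mulVec, dotProduct]
    calc ∑ b, Zm a b * s b ≤ ∑ b, C₁ * (Kr * s a) :=
          sum_le_sum fun b _ => mul_le_mul (hZm_le a b) (hratio a b) (hs0 b) hC₁0
      _ = F * C₁ * Kr * s a := by rw [sum_const, nsmul_eq_mul, hF, Finset.card_univ]; ring
      _ ≤ K₁ * s a := by rw [hK₁]; nlinarith [hspos a]
  have hz0 : 0 ≤ z := nonnegMat_mulVec_nonneg_of_nonneg hZm0 hs0
  -- ★ the induction on the length bound
  have key : ∀ n j, (j = 0 → UcM T N n 0 y *ᵥ s ≤ z - s) ∧ (1 ≤ j → UcM T N n j y *ᵥ s ≤ K₁ • s) := by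
    intro n
    induction n with
    | zero =>
      intro j
      have h0 : ∀ j', UcM T N 0 j' y = 0 := fun j' => by ext a b; exact UcM_zero y a b
      refine ⟨fun _ => ?_, fun _ => ?_⟩
      · rw [h0, Matrix.zero_mulVec]; intro a; simp only [Pi.zero_apply, Pi.sub_apply]
        have hMz : 0 ≤ (M0 *ᵥ z) a := by have := (nonnegMat_mulVec_nonneg_of_nonneg hM00 hz0) a; simpa using this
        linarith [hz_eq a]
      · rw [h0, Matrix.zero_mulVec]; intro a; simp only [Pi.zero_apply, Pi.smul_apply, smul_eq_mul]
        nlinarith [hspos a, hK₁, mul_nonneg (mul_nonneg (by positivity : (0:ℝ) ≤ F) hC₁0) hKr0]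
    | succ n ih =>
      intro j
      -- the split inequality, applied to `s`
      have hsplit : UcM T N (n + 1) j y *ᵥ s ≤
          McM T N j y *ᵥ s + ∑ i ∈ range (j + 1), McM T N i y *ᵥ (UcM T N n (j - i) y *ᵥ s) := by
        have h1 : UcM T N (n + 1) j y *ᵥ s ≤ (McM T N j y + ∑ i ∈ range (j + 1), McM T N i y * UcM T N n (j - i) y) *ᵥ s :=
          nonnegMat_mulVec_le_mulVec_of_entry_le (fun a b => UcM_succ_le hy0 a b) hs0
        refine h1.trans (le_of_eq ?_)
        rw [Matrix.add_mulVec, Matrix.sum_mulVec]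
        congr 1
        exact sum_congr rfl fun i _ => (Matrix.mulVec_mulVec _ _ _).symm
      refine ⟨fun hj => ?_, fun hj => ?_⟩
      · -- `j = 0`: `U s ≤ M0 s + M0 (z − s) = M0 z = z − s`
        subst hj
        have h2 : McM T N 0 y *ᵥ s + ∑ i ∈ range 1, McM T N i y *ᵥ (UcM T N n (0 - i) y *ᵥ s) ≤ z - s := by
          rw [sum_range_one, Nat.sub_zero]
          have h3 : McM T N 0 y *ᵥ (UcM T N n 0 y *ᵥ s) ≤ McM T N 0 y *ᵥ (z - s) :=
            nonnegMat_mulVec_le_mulVec_of_le hM00 ((ih 0).1 rfl)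
          intro a
          have h4 := h3 a
          simp only [Pi.add_apply, Pi.sub_apply] at h4 ⊢
          have h5 : (McM T N 0 y *ᵥ (z - s)) a = (M0 *ᵥ z) a - (M0 *ᵥ s) a := by
            rw [hM0, Matrix.mulVec_sub]; rfl
          linarith [hz_eq a]
        exact hsplit.trans h2
      · -- `j ≥ 1`: `U s ≤ M_j s + M0 (K₁ s) + Σ_{1 ≤ i < j} M_i (K₁ s) + M_j (z − s) ≤ K₁ (Σ_{i ≤ j} M_i) s ≤ K₁ s`
        have hterm : ∀ i ∈ range (j + 1), McM T N i y *ᵥ (UcM T N n (j - i) y *ᵥ s) ≤ K₁ • (McM T N i y *ᵥ s) -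
            (if i = j then McM T N j y *ᵥ s else 0) := by
          intro i hi
          rw [mem_range] at hi
          by_cases hij : i = j
          · subst hij
            rw [if_pos rfl, Nat.sub_self]
            calc McM T N i y *ᵥ (UcM T N n 0 y *ᵥ s) ≤ McM T N i y *ᵥ (z - s) :=
                  nonnegMat_mulVec_le_mulVec_of_le (McM_nonneg hy0 i) ((ih 0).1 rfl)
              _ ≤ McM T N i y *ᵥ (K₁ • s - s) :=
                  nonnegMat_mulVec_le_mulVec_of_le (McM_nonneg hy0 i) fun a => by
                    simp only [Pi.sub_apply, Pi.smul_apply, smul_eq_mul]; linarith [hz_le a]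
              _ = K₁ • (McM T N i y *ᵥ s) - McM T N i y *ᵥ s := by rw [Matrix.mulVec_sub, Matrix.mulVec_smul]
          · rw [if_neg hij, sub_zero]
            calc McM T N i y *ᵥ (UcM T N n (j - i) y *ᵥ s) ≤ McM T N i y *ᵥ (K₁ • s) :=
                  nonnegMat_mulVec_le_mulVec_of_le (McM_nonneg hy0 i) ((ih (j - i)).2 (by omega))
              _ = K₁ • (McM T N i y *ᵥ s) := by rw [Matrix.mulVec_smul]
        have hsum : ∑ i ∈ range (j + 1), McM T N i y *ᵥ (UcM T N n (j - i) y *ᵥ s) ≤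
            K₁ • ((∑ i ∈ range (j + 1), McM T N i y) *ᵥ s) - McM T N j y *ᵥ s := by
          calc ∑ i ∈ range (j + 1), McM T N i y *ᵥ (UcM T N n (j - i) y *ᵥ s)
              ≤ ∑ i ∈ range (j + 1), (K₁ • (McM T N i y *ᵥ s) - (if i = j then McM T N j y *ᵥ s else 0)) := sum_le_sum hterm
            _ = K₁ • ((∑ i ∈ range (j + 1), McM T N i y) *ᵥ s) - McM T N j y *ᵥ s := by
                rw [sum_sub_distrib, sum_ite_eq' (range (j + 1)) j, if_pos (mem_range.2 (by omega)), ← smul_sum, Matrix.sum_mulVec]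
        have hIs : (∑ i ∈ range (j + 1), McM T N i y) *ᵥ s ≤ s :=
          (nonnegMat_mulVec_le_mulVec_of_entry_le (fun a b => sum_McM_le_Iinf hT hy (j + 1) a b) hs0).trans hAs
        have hK₁0 : 0 ≤ K₁ := by rw [hK₁]; nlinarith [mul_nonneg (mul_nonneg (by positivity : (0:ℝ) ≤ F) hC₁0) hKr0]
        calc UcM T N (n + 1) j y *ᵥ s ≤ McM T N j y *ᵥ s + ∑ i ∈ range (j + 1), McM T N i y *ᵥ (UcM T N n (j - i) y *ᵥ s) := hsplit
          _ ≤ McM T N j y *ᵥ s + (K₁ • ((∑ i ∈ range (j + 1), McM T N i y) *ᵥ s) - McM T N j y *ᵥ s) := add_le_add le_rfl hsum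
          _ = K₁ • ((∑ i ∈ range (j + 1), McM T N i y) *ᵥ s) := by abel
          _ ≤ K₁ • s := smul_le_smul_of_nonneg_left hIs hK₁0
  -- conclusion: `U(a,b) s_b ≤ (U s)_a ≤ K₁ s_a`, `s_a ≤ Kr s_b`
  have hUs : (UcM T N n j y *ᵥ s) a ≤ K₁ * s a := by
    rcases Nat.eq_zero_or_pos j with rfl | hj
    · have := ((key n 0).1 rfl) a
      simp only [Pi.sub_apply] at this
      linarith [hz_le a, hspos a]
    · have := ((key n j).2 hj) a
      simpa using this
  have h1 : UcM T N n j y a b * s b ≤ (UcM T N n j y *ᵥ s) a := nonnegMat_apply_mul_le_mulVec (UcM_nonneg hy0 n j) hs0 a b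
  have h2 : UcM T N n j y a b * s b ≤ K₁ * (Kr * s b) := by
    calc UcM T N n j y a b * s b ≤ K₁ * s a := h1.trans hUs
      _ ≤ K₁ * (Kr * s b) := by
          have hK₁0 : 0 ≤ K₁ := by rw [hK₁]; nlinarith [mul_nonneg (mul_nonneg (by positivity : (0:ℝ) ≤ F) hC₁0) hKr0]
          exact mul_le_mul_of_nonneg_left (hratio b a) hK₁0
  exact le_of_mul_le_mul_right (by linarith) (hspos b)

/-- ★★★ **The `y_T^j`-weighted contact slices of the horizontal-bridge series are uniformly bounded**: there is `K = K(T)` with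
`Ucs T N N j a b (y_T) = Σ_{h : a → b, ≤ N+1 vertices, j contacts} x_c^{|h|−1} y_T^j ≤ K` for all `N, j, a, b` — the renewal core of
the pointwise threshold law. [cite: DuminilCopinHammond2013, §2.2; Seneta1973, §6.2 Theorem 6.3; lane (NEXT-TARGETS)] -/
theorem exists_Ucs_stripYT_le (hT : 1 ≤ T) :
    ∃ K : ℝ, ∀ N j (a b : Fin (2 * T)), Ucs T N N j (a : ℕ) (b : ℕ) (stripYT T) ≤ K := by
  obtain ⟨K, hK⟩ := exists_UcM_le hT
  have h1T := one_lt_stripYT hT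
  refine ⟨K, fun N j a b => ?_⟩
  -- continuity of the finite sum `y ↦ Ucs … y` at `y_T` from the left
  have hcont : ContinuousAt (fun y : ℝ => Ucs T N N j (a : ℕ) (b : ℕ) y) (stripYT T) := by
    unfold Ucs wD
    exact (continuous_finsetSum _ fun l _ => continuous_const.mul (continuous_pow _)).continuousAt
  have hlim : Tendsto (fun y : ℝ => Ucs T N N j (a : ℕ) (b : ℕ) y) (𝓝[<] stripYT T) (𝓝 (Ucs T N N j (a : ℕ) (b : ℕ) (stripYT T))) :=
    tendsto_nhdsWithin_of_tendsto_nhds hcont.tendsto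
  refine le_of_tendsto hlim ?_
  have hmem : Set.Ico (1 : ℝ) (stripYT T) ∈ 𝓝[<] stripYT T := Ico_mem_nhdsLT h1T
  filter_upwards [hmem] with y hy
  exact hK y hy N N j a b

end Analytic

/-! ### §3 ★★★ The pointwise threshold law: `β_{T,m}(x_c) · y_T^m ≤ C` for all `m` -/

section Transfer

variable {T : ℕ}

/-- `β_{T,L,m} = Σ_{bridge lists l of S_{T,L} with m contacts} x_c^{|l|}` (coefficient-level bridge-list representation).
[cite: BeatonBousquetMelouDeGierDuminilCopinGuttmann2014, §3.2 (B_{T,L}(x; y) = Σ_m β_{T,L,m} y^m)] -/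
theorem stripBcoeffY_eq_sum_bridgeLists (hT : 1 ≤ T) (L m : ℕ) :
    stripBcoeffY T L m = ∑ l ∈ (bridgeLists T L).filter (fun l => topCnt T l = m), hexCriticalFugacity ^ l.length := by
  classical
  rw [stripBcoeffY, bridgeLists, Finset.filter_image, sum_image]
  · refine sum_congr ?_ fun P hP => ?_
    · ext P
      simp only [mem_filter, surfContacts, topCnt]
    · rw [mem_filter, mem_filter, mem_midWalks_iff] at hP
      rw [hP.1.1.length_inner]
  · intro P hP P' hP' h
    rw [mem_coe, mem_filter, mem_filter, mem_midWalks_iff] at hP hP'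
    obtain ⟨l, hl, rfl, -⟩ := eq_of_isBetaDart hT hP.1.1 hP.1.2
    obtain ⟨l', hl', rfl, -⟩ := eq_of_isBetaDart hT hP'.1.1 hP'.1.2
    simp only [inner_cons_append] at h
    subst h; rfl

/-- `Σ_{s ∪ t} f ≤ Σ_s f + Σ_t f` for `f ≥ 0` (plumbing). [cite: DuminilCopinHammond2013, §2.2 (bridges of the strip); lane plumbing] (Edition 6: `private` — generic plumbing; a statement-twin `Literature.MathematicalPhysics.QuantumFieldTheory.Dimock2011to13.SteinerLengthSums.sum_union_le_of_nonneg_on` exists or may appear in an unrelated tree module, which this file does not import.) -/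
private theorem hvSum_union_le_add {α : Type*} [DecidableEq α] (s t : Finset α) (f : α → ℝ) (hf : ∀ x ∈ s ∪ t, 0 ≤ f x) :
    ∑ x ∈ s ∪ t, f x ≤ ∑ x ∈ s, f x + ∑ x ∈ t, f x := by
  rw [← Finset.sum_union_inter]
  have : 0 ≤ ∑ x ∈ s ∩ t, f x := sum_nonneg fun x hx => hf x (mem_union.2 (Or.inl (mem_inter.1 hx).1))
  linarith

/-- `Σ_{⋃_i t i} f ≤ Σ_i Σ_{t i} f` for `f ≥ 0` (plumbing). [cite: DuminilCopinHammond2013, §2.2 (bridges of the strip); lane plumbing] (Edition 6: `private` — generic plumbing; a statement-twin exists or may appear in an unrelated tree module, which this file does not import.) -/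
private theorem hvSum_biUnion_le_sum_sum {ι α : Type*} [DecidableEq α] (s : Finset ι) (t : ι → Finset α) (f : α → ℝ)
    (hf : ∀ x, 0 ≤ f x) : ∑ x ∈ s.biUnion t, f x ≤ ∑ i ∈ s, ∑ x ∈ t i, f x := by
  classical
  induction s using Finset.induction_on with
  | empty => simp
  | insert a s ha ih =>
    rw [Finset.biUnion_insert, Finset.sum_insert ha]
    exact (hvSum_union_le_add _ _ f fun x _ => hf x).trans (add_le_add le_rfl ih)

/-- The sliced horizontal-bridge sum at `y`: `Σ_{h ∈ hBridgesN T N, #top(h) = j} x_c^{|h|} y^j` (plumbing). [folklore] -/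
def hbSlice (T N j : ℕ) (y : ℝ) : ℝ :=
  ∑ h ∈ (hBridgesN T N).filter (fun h => topCnt T h = j), hexCriticalFugacity ^ h.length * y ^ topCnt T h

set_option maxHeartbeats 400000 in
/-- ★ **The sliced horizontal-bridge sums at `y_T` are bounded uniformly in the slice and the truncation**
(`hbSlice T N j y_T ≤ K₂`): singletons aside, a bridge with `j` contacts has `j` or `j − 1` contacts off its start vertex, and the
level classes are bounded by `exists_Ucs_stripYT_le`. [cite: DuminilCopinHammond2013, §2.2; lane (NEXT-TARGETS)] -/
theorem exists_hbSlice_stripYT_le (hT : 1 ≤ T) : ∃ K₂ : ℝ, ∀ N j, hbSlice T N j (stripYT T) ≤ K₂ := by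
  classical
  obtain ⟨K, hK⟩ := exists_Ucs_stripYT_le hT
  have hx := hexCriticalFugacity_pos_lt_one
  have hyT := one_lt_stripYT hT
  have hyT0 : 0 ≤ stripYT T := by linarith
  have hK0 : 0 ≤ K := le_trans (Ucs_Mcs_nonneg (T := T) (N := 0) (n := 0) (j := 0) hyT0 ((⟨0, by omega⟩ : Fin (2 * T)) : ℕ)
    ((⟨0, by omega⟩ : Fin (2 * T)) : ℕ)).1 (hK 0 0 ⟨0, by omega⟩ ⟨0, by omega⟩)
  set S0 : ℝ := ((stripChains T 0).card : ℝ) with hS0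
  set F : ℝ := (Fintype.card (Fin (2 * T) × Fin (2 * T)) : ℝ) with hF
  refine ⟨hexCriticalFugacity * stripYT T * (S0 + 2 * (F * K)), fun N j => ?_⟩
  rw [hbSlice]
  set Sl := (hBridgesN T N).filter (fun h => topCnt T h = j) with hSl
  set S1 := Sl.filter (fun h => h.length < 2) with hS1
  set S2 := Sl.filter (fun h => 2 ≤ h.length) with hS2
  have hsplit : ∑ h ∈ Sl, hexCriticalFugacity ^ h.length * stripYT T ^ topCnt T h =
      ∑ h ∈ S1, hexCriticalFugacity ^ h.length * stripYT T ^ topCnt T h +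
        ∑ h ∈ S2, hexCriticalFugacity ^ h.length * stripYT T ^ topCnt T h := by
    rw [hS1, hS2, ← sum_filter_add_sum_filter_not Sl (fun h => h.length < 2)]
    congr 1
    exact sum_congr (filter_congr fun l _ => not_lt) fun _ _ => rfl
  -- singletons: at most `#stripChains T 0` of them, each of weight `≤ x_c y_T`
  have h1 : ∑ h ∈ S1, hexCriticalFugacity ^ h.length * stripYT T ^ topCnt T h ≤ hexCriticalFugacity * stripYT T * S0 := by
    calc ∑ h ∈ S1, hexCriticalFugacity ^ h.length * stripYT T ^ topCnt T h ≤ ∑ h ∈ S1, hexCriticalFugacity * stripYT T := by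
          refine sum_le_sum fun h hh => ?_
          rw [hS1, mem_filter, hSl, mem_filter] at hh
          obtain ⟨⟨hh, -⟩, hlt⟩ := hh
          obtain ⟨-, -, -, -, -, ⟨hne, -⟩⟩ := mem_hBridgesN_iff.1 hh
          obtain ⟨v, t, rfl⟩ := List.exists_cons_of_ne_nil hne
          have ht : t = [] := by simpa using (by simpa using hlt : t.length < 1)
          subst ht
          rw [List.length_singleton, pow_one, topCnt_singleton]
          refine mul_le_mul_of_nonneg_left ?_ hx.1.le
          split_ifs
          · rw [pow_one]
          · rw [pow_zero]; exact hyT.le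
      _ = hexCriticalFugacity * stripYT T * S1.card := by rw [sum_const, nsmul_eq_mul]; ring
      _ ≤ hexCriticalFugacity * stripYT T * S0 := by
          refine mul_le_mul_of_nonneg_left ?_ (mul_nonneg hx.1.le hyT0)
          rw [hS0]
          exact_mod_cast card_le_card fun h hh => by
            rw [hS1, mem_filter, hSl, mem_filter, mem_hBridgesN_iff] at hh
            obtain ⟨⟨⟨hc, hnd, -, hhd, hin, ⟨hne, -⟩⟩, -⟩, hlt⟩ := hh
            exact mem_stripChains_iff.2 ⟨hc, hnd, by have := List.length_pos_of_ne_nil hne; omega, hhd, hin⟩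
  -- longer bridges: `x_c y_T^{[head top]} · wD_{y_T}`, with `j` or `j - 1` contacts off the start, in some level class
  have h2 : ∑ h ∈ S2, hexCriticalFugacity ^ h.length * stripYT T ^ topCnt T h ≤
      hexCriticalFugacity * stripYT T * (2 * (F * K)) := by
    -- the two candidate slices, summed over all level pairs
    set V : ℝ := ∑ ab : Fin (2 * T) × Fin (2 * T), (Ucs T N N j (ab.1 : ℕ) (ab.2 : ℕ) (stripYT T) +
      Ucs T N N (j - 1) (ab.1 : ℕ) (ab.2 : ℕ) (stripYT T)) with hV
    have hVle : V ≤ 2 * (F * K) := by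
      calc V ≤ ∑ _ab : Fin (2 * T) × Fin (2 * T), (K + K) := sum_le_sum fun ab _ => add_le_add (hK N j _ _) (hK N (j - 1) _ _)
        _ = 2 * (F * K) := by rw [sum_const, nsmul_eq_mul, hF, Finset.card_univ]; ring
    -- termwise bound and injection into the level classes
    have hterm : ∀ h ∈ S2, hexCriticalFugacity ^ h.length * stripYT T ^ topCnt T h ≤
        hexCriticalFugacity * stripYT T * wD T (stripYT T) h := by
      intro h hh
      rw [hS2, mem_filter, hSl, mem_filter] at hh
      obtain ⟨⟨hh, -⟩, h2⟩ := hh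
      obtain ⟨-, -, -, -, -, ⟨hne, -⟩⟩ := mem_hBridgesN_iff.1 hh
      obtain ⟨v, t, rfl⟩ := List.exists_cons_of_ne_nil hne
      rw [wD, topCnt_cons, List.length_cons, List.tail_cons, Nat.add_sub_cancel, pow_succ, pow_add]
      have hle : stripYT T ^ (if lev v = 2 * (T : ℤ) - 1 then 1 else 0) ≤ stripYT T := by
        split_ifs
        · rw [pow_one]
        · rw [pow_zero]; exact hyT.le
      have e0 : 0 ≤ hexCriticalFugacity ^ t.length := pow_nonneg hx.1.le _
      have e1 : 0 ≤ stripYT T ^ topCnt T t := pow_nonneg hyT0 _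
      calc hexCriticalFugacity ^ t.length * hexCriticalFugacity * (stripYT T ^ (if lev v = 2 * (T : ℤ) - 1 then 1 else 0) *
            stripYT T ^ topCnt T t) ≤ hexCriticalFugacity ^ t.length * hexCriticalFugacity * (stripYT T * stripYT T ^ topCnt T t) :=
            mul_le_mul_of_nonneg_left (mul_le_mul_of_nonneg_right hle e1) (mul_nonneg e0 hx.1.le)
        _ = hexCriticalFugacity * stripYT T * (hexCriticalFugacity ^ t.length * stripYT T ^ topCnt T t) := by ring
    -- `S2 ⊆ ⋃_{ab} (Uset j ∪ Uset (j-1))`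
    have hcover : ∑ h ∈ S2, wD T (stripYT T) h ≤ V := by
      have hsub : ∀ h ∈ S2, ∃ ab : Fin (2 * T) × Fin (2 * T),
          h ∈ Uset T N N j (ab.1 : ℕ) (ab.2 : ℕ) ∪ Uset T N N (j - 1) (ab.1 : ℕ) (ab.2 : ℕ) := by
        intro h hh
        rw [hS2, mem_filter, hSl, mem_filter] at hh
        obtain ⟨⟨hh, hj⟩, h2⟩ := hh
        have hne : h ≠ [] := List.ne_nil_of_length_pos (by omega)
        obtain ⟨hc, hnd, hlen, hhd, hin, hB⟩ := mem_hBridgesN_iff.1 hh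
        obtain ⟨b1, b2, b3, b4⟩ := hdLev_ltLev_bounds hin hne
        refine ⟨(⟨(hdLev h).toNat, by omega⟩, ⟨(ltLev h).toNat, by omega⟩), ?_⟩
        have hab : h ∈ HBab T N (hdLev h) (ltLev h) := by rw [HBab, mem_filter]; exact ⟨hh, h2, rfl, rfl⟩
        obtain ⟨v, t, rfl⟩ := List.exists_cons_of_ne_nil hne
        rw [topCnt_cons] at hj
        rw [mem_union, Uset, Uset, mem_filter, mem_filter]
        simp only [List.tail_cons]
        have e1 : (((⟨(hdLev (v :: t)).toNat, by omega⟩ : Fin (2 * T)) : ℕ) : ℤ) = hdLev (v :: t) := by simp; omega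
        have e2 : (((⟨(ltLev (v :: t)).toNat, by omega⟩ : Fin (2 * T)) : ℕ) : ℤ) = ltLev (v :: t) := by simp; omega
        rw [e1, e2]
        split_ifs at hj
        · exact Or.inr ⟨hab, by omega, hlen⟩
        · exact Or.inl ⟨hab, by omega, hlen⟩
      calc ∑ h ∈ S2, wD T (stripYT T) h
          ≤ ∑ h ∈ (univ : Finset (Fin (2 * T) × Fin (2 * T))).biUnion
              (fun ab => Uset T N N j (ab.1 : ℕ) (ab.2 : ℕ) ∪ Uset T N N (j - 1) (ab.1 : ℕ) (ab.2 : ℕ)), wD T (stripYT T) h := by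
            refine sum_le_sum_of_subset_of_nonneg (fun h hh => ?_) fun _ _ _ => wD_nonneg T hyT0 _
            obtain ⟨ab, hab⟩ := hsub h hh
            exact mem_biUnion.2 ⟨ab, mem_univ _, hab⟩
        _ ≤ ∑ ab : Fin (2 * T) × Fin (2 * T), ∑ h ∈ Uset T N N j (ab.1 : ℕ) (ab.2 : ℕ) ∪ Uset T N N (j - 1) (ab.1 : ℕ) (ab.2 : ℕ),
              wD T (stripYT T) h := hvSum_biUnion_le_sum_sum _ _ _ (fun h => wD_nonneg T hyT0 h)
        _ ≤ V := by
            rw [hV]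
            refine sum_le_sum fun ab _ => ?_
            rw [Ucs, Ucs]
            exact hvSum_union_le_add _ _ _ (fun h _ => wD_nonneg T hyT0 h)
    calc ∑ h ∈ S2, hexCriticalFugacity ^ h.length * stripYT T ^ topCnt T h ≤ ∑ h ∈ S2, hexCriticalFugacity * stripYT T * wD T (stripYT T) h :=
          sum_le_sum hterm
      _ = hexCriticalFugacity * stripYT T * ∑ h ∈ S2, wD T (stripYT T) h := by rw [mul_sum]
      _ ≤ hexCriticalFugacity * stripYT T * (2 * (F * K)) :=
          mul_le_mul_of_nonneg_left (hcover.trans hVle) (mul_nonneg hx.1.le hyT0)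
  rw [hsplit, mul_add]
  exact add_le_add h1 h2

end Transfer

/-! ### §4 ★★★ Assembly: the sliced case-A bound, the mirror on slices, and `β_{T,m} y_T^m ≤ C` -/

section Final

variable {T L : ℕ} {l : List HV}

/-- The contacts of a case-A bridge list split over its three pieces: `#top(l) = #top(mid) + #top(tail.tail)` (read off from the
weight identity at `y = 1` and `y = 2`). [cite: DuminilCopinHammond2013, §2.2 (bridges of the strip); lane plumbing] -/
theorem topCnt_eq_decTriple (hc : l.IsChain hvGraph.Adj) (hnd : l.Nodup) (hV : ∀ v ∈ l, v ∈ stripV T L)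
    (hh : l.head? = some hvOrigin) (hst : sIdx l < tIdx l) :
    topCnt T l = topCnt T (decTriple l).2.1 + topCnt T (decTriple l).2.2.tail := by
  have hx := hexCriticalFugacity_pos_lt_one
  have h1 := wt_eq_tripleWt_decTriple hc hnd hV hh hst 1
  have h2 := wt_eq_tripleWt_decTriple hc hnd hV hh hst 2
  simp only [tripleWt, one_pow, mul_one] at h1 h2
  rw [h1] at h2
  -- cancel the (positive) `x_c`-part
  have hpos : 0 < hexCriticalFugacity ^ ((decTriple l).1.length - 1) * hexCriticalFugacity ^ (decTriple l).2.1.length *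
      hexCriticalFugacity ^ ((decTriple l).2.2.length - 1) := mul_pos (mul_pos (pow_pos hx.1 _) (pow_pos hx.1 _)) (pow_pos hx.1 _)
  have h3 : (2 : ℝ) ^ topCnt T l = 2 ^ (topCnt T (decTriple l).2.1 + topCnt T (decTriple l).2.2.tail) := by
    rw [pow_add]; nlinarith [hpos, h2, pow_pos (two_pos : (0:ℝ) < 2) (topCnt T l),
      pow_pos (two_pos : (0:ℝ) < 2) (topCnt T (decTriple l).2.1), pow_pos (two_pos : (0:ℝ) < 2) (topCnt T (decTriple l).2.2.tail)]
  exact pow_right_injective₀ (by norm_num : (0 : ℝ) < 2) (by norm_num : (2 : ℝ) ≠ 1) h3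

set_option maxHeartbeats 400000 in
/-- ★ **The sliced case-A bound**: `Σ_{l ∈ caseA, #top(l) = m} x_c^{|l|} y_T^m ≤ F₁ · K₂ · F₃(y_T)` whenever every contact slice of the
horizontal-bridge series at `y_T` is `≤ K₂`. [cite: DuminilCopinHammond2013, §2.2; BeatonBousquetMelouDeGierDuminilCopinGuttmann2014, §4; lane (NEXT-TARGETS)] -/
theorem sum_caseA_slice_le (hT : 1 ≤ T) {N : ℕ} (hN : (stripV T L).card ≤ N + 1) (m : ℕ) {K₂ : ℝ}
    (hK₂ : ∀ j, hbSlice T N j (stripYT T) ≤ K₂) :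
    ∑ l ∈ (caseA T L).filter (fun l => topCnt T l = m), hexCriticalFugacity ^ l.length * stripYT T ^ m ≤
      topFreeSumN T N * K₂ * botFreeSumN T N (stripYT T) := by
  classical
  have hx := hexCriticalFugacity_pos_lt_one
  have hyT0 : 0 ≤ stripYT T := by linarith [one_lt_stripYT hT]
  have hK₂0 : 0 ≤ K₂ := le_trans (sum_nonneg fun h _ => mul_nonneg (pow_nonneg hx.1.le _) (pow_nonneg hyT0 _)) (hK₂ 0)
  set yT := stripYT T with hyT
  have hmem : ∀ l ∈ (caseA T L).filter (fun l => topCnt T l = m), l.IsChain hvGraph.Adj ∧ l.head? = some hvOrigin ∧ l.Nodup ∧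
      (∀ v ∈ l, v ∈ stripV T L) ∧ (∃ h : l ≠ [], lev (l.getLast h) = 2 * (T : ℤ) - 1) ∧ sIdx l < tIdx l ∧ l.length ≤ N + 1 ∧
      topCnt T l = m := by
    intro l hl
    rw [mem_filter, caseA, mem_filter] at hl
    obtain ⟨hc, hh, hnd, hV, hlast⟩ := (mem_bridgeLists_iff hT).1 hl.1.1
    exact ⟨hc, hh, hnd, hV, hlast, hl.1.2, (length_le_card_stripV hT hl.1.1).trans hN, hl.2⟩
  -- the weight of each piece
  set wq : List HV → ℝ := fun q => hexCriticalFugacity ^ (q.length - 1) with hwq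
  set wh : List HV → ℝ := fun h => hexCriticalFugacity ^ h.length * yT ^ topCnt T h with hwh
  set wr : List HV → ℝ := fun r => hexCriticalFugacity ^ (r.length - 1) * yT ^ topCnt T r.tail with hwr
  have hwq0 : ∀ q, 0 ≤ wq q := fun q => pow_nonneg hx.1.le _
  have hwh0 : ∀ h, 0 ≤ wh h := fun h => mul_nonneg (pow_nonneg hx.1.le _) (pow_nonneg hyT0 _)
  have hwr0 : ∀ r, 0 ≤ wr r := fun r => mul_nonneg (pow_nonneg hx.1.le _) (pow_nonneg hyT0 _)
  -- the summand as an indicator over the product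
  set g : List HV × List HV × List HV → ℝ := fun t =>
    if topCnt T t.2.1 + topCnt T t.2.2.tail = m then wq t.1 * (wh t.2.1 * wr t.2.2) else 0 with hg
  have hg0 : ∀ t, 0 ≤ g t := fun t => by
    simp only [hg]; split_ifs
    · exact mul_nonneg (hwq0 _) (mul_nonneg (hwh0 _) (hwr0 _))
    · exact le_rfl
  calc ∑ l ∈ (caseA T L).filter (fun l => topCnt T l = m), hexCriticalFugacity ^ l.length * yT ^ m
      = ∑ l ∈ (caseA T L).filter (fun l => topCnt T l = m), g (decTriple l) := by
        refine sum_congr rfl fun l hl => ?_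
        obtain ⟨hc, hh, hnd, hV, -, hst, -, htop⟩ := hmem l hl
        have hsplit := topCnt_eq_decTriple hc hnd hV hh hst
        have hwt := wt_eq_tripleWt_decTriple hc hnd hV hh hst yT
        have hcond : topCnt T (decTriple l).2.1 + topCnt T (decTriple l).2.2.tail = m := by rw [← hsplit]; exact htop
        simp only [hg, if_pos hcond, hwq, hwh, hwr]
        rw [← htop, hwt, tripleWt]
        ring
    _ = ∑ t ∈ ((caseA T L).filter (fun l => topCnt T l = m)).image decTriple, g t := by
        rw [sum_image]
        intro l hl l' hl' h
        have h1 := hmem l hl; have h2 := hmem l' hl'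
        exact decTriple_injOn ⟨by rintro rfl; simp at h1, h1.2.2.2.2.2.1⟩ ⟨by rintro rfl; simp at h2, h2.2.2.2.2.2.1⟩ h
    _ ≤ ∑ t ∈ topFreeN T N ×ˢ (hBridgesN T N ×ˢ botFreeN T N), g t := by
        refine sum_le_sum_of_subset_of_nonneg (fun t ht => ?_) fun t _ _ => hg0 t
        rw [mem_image] at ht
        obtain ⟨l, hl, rfl⟩ := ht
        obtain ⟨hc, hh, hnd, hV, ⟨hne, hlast⟩, hst, hlen, -⟩ := hmem l hl
        rw [decTriple, mem_product, mem_product]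
        exact ⟨headP_mem_topFreeN hc hnd hV hh hst hlen, xstd_midP_mem_hBridgesN hc hnd hV hh hst hlen,
          xstd_tailP_mem_botFreeN hc hnd hV hlast hst hlen⟩
    _ = ∑ q ∈ topFreeN T N, ∑ r ∈ botFreeN T N, wq q * wr r *
          ∑ h ∈ hBridgesN T N, (if topCnt T h + topCnt T r.tail = m then wh h else 0) := by
        rw [sum_product]
        refine sum_congr rfl fun q _ => ?_
        rw [sum_product, sum_comm]
        refine sum_congr rfl fun r _ => ?_
        rw [mul_sum]
        refine sum_congr rfl fun h _ => ?_
        simp only [hg]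
        split_ifs <;> ring
    _ ≤ ∑ q ∈ topFreeN T N, ∑ r ∈ botFreeN T N, wq q * wr r * K₂ := by
        refine sum_le_sum fun q _ => sum_le_sum fun r _ => mul_le_mul_of_nonneg_left ?_ (mul_nonneg (hwq0 q) (hwr0 r))
        -- the inner sum is a contact slice (or empty)
        by_cases hle : topCnt T r.tail ≤ m
        · calc ∑ h ∈ hBridgesN T N, (if topCnt T h + topCnt T r.tail = m then wh h else 0)
              = hbSlice T N (m - topCnt T r.tail) yT := by
                rw [hbSlice, sum_filter]
                refine sum_congr rfl fun h _ => ?_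
                by_cases h1 : topCnt T h + topCnt T r.tail = m
                · rw [if_pos h1, if_pos (by omega)]
                · rw [if_neg h1, if_neg (by omega)]
            _ ≤ K₂ := hK₂ _
        · calc ∑ h ∈ hBridgesN T N, (if topCnt T h + topCnt T r.tail = m then wh h else 0) = 0 :=
                sum_eq_zero fun h _ => by rw [if_neg (by omega)]
            _ ≤ K₂ := hK₂0
    _ = topFreeSumN T N * K₂ * botFreeSumN T N yT := by
        rw [topFreeSumN, botFreeSumN, sum_mul, sum_mul]
        refine sum_congr rfl fun q _ => ?_
        rw [mul_sum]
        refine sum_congr rfl fun r _ => ?_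
        simp only [hwq, hwr]; ring

/-- The mirror maps the `m`-contact slice of case B injectively into the `m`-contact slice of case A.
[cite: DuminilCopinSmirnov2012, §3 (the symmetry of S_{T,L}); lane] -/
theorem sum_caseB_slice_le (hT : 1 ≤ T) (m : ℕ) :
    ∑ l ∈ (caseB T L).filter (fun l => topCnt T l = m), hexCriticalFugacity ^ l.length ≤
      ∑ l ∈ (caseA T L).filter (fun l => topCnt T l = m), hexCriticalFugacity ^ l.length := by
  classical
  have hinj : Set.InjOn (fun l : List HV => l.map mirrorX) ((caseB T L).filter (fun l => topCnt T l = m) : Set (List HV)) :=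
    fun l _ l' _ h => (List.map_injective_iff.2 mirrorX.injective) h
  calc ∑ l ∈ (caseB T L).filter (fun l => topCnt T l = m), hexCriticalFugacity ^ l.length
      = ∑ l ∈ (caseB T L).filter (fun l => topCnt T l = m), hexCriticalFugacity ^ (l.map mirrorX).length := by
        simp only [List.length_map]
    _ = ∑ l ∈ ((caseB T L).filter (fun l => topCnt T l = m)).image fun l => l.map mirrorX, hexCriticalFugacity ^ l.length := by
        rw [sum_image hinj]
    _ ≤ ∑ l ∈ (caseA T L).filter (fun l => topCnt T l = m), hexCriticalFugacity ^ l.length := by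
        refine sum_le_sum_of_subset_of_nonneg (fun l' hl' => ?_) fun _ _ _ => pow_nonneg hexCriticalFugacity_pos_lt_one.1.le _
        rw [mem_image] at hl'
        obtain ⟨l, hl, rfl⟩ := hl'
        rw [mem_filter, caseB, mem_filter] at hl
        rw [mem_filter, caseA, mem_filter, sIdx_map_mirrorX, tIdx_map_mirrorX, topCnt_map_mirrorX]
        exact ⟨⟨map_mirrorX_mem_bridgeLists hT hl.1.1, hl.1.2⟩, hl.2⟩

/-- ★★ **`β_{T,L,m} y_T^m ≤ 2 F₁ K₂ F₃(y_T)`** for every box `S_{T,L}` and every `m`.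
[cite: BeatonBousquetMelouDeGierDuminilCopinGuttmann2014, §3.2 and §4; lane (NEXT-TARGETS)] -/
theorem stripBcoeffY_mul_pow_le (hT : 1 ≤ T) (L m : ℕ) {N : ℕ} (hN : (stripV T L).card ≤ N + 1) {K₂ : ℝ}
    (hK₂ : ∀ j, hbSlice T N j (stripYT T) ≤ K₂) :
    stripBcoeffY T L m * stripYT T ^ m ≤ 2 * (topFreeSumN T N * K₂ * botFreeSumN T N (stripYT T)) := by
  classical
  have hx := hexCriticalFugacity_pos_lt_one
  have hyT0 : 0 ≤ stripYT T := by linarith [one_lt_stripYT hT]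
  rw [stripBcoeffY_eq_sum_bridgeLists hT, bridgeLists_eq_caseA_union_caseB hT, filter_union]
  have hdisj : Disjoint ((caseA T L).filter (fun l => topCnt T l = m)) ((caseB T L).filter (fun l => topCnt T l = m)) := by
    rw [disjoint_left]
    intro l h1 h2
    rw [mem_filter, caseA, mem_filter] at h1
    rw [mem_filter, caseB, mem_filter] at h2
    omega
  rw [sum_union hdisj, add_mul]
  have hA := sum_caseA_slice_le hT hN m hK₂ (L := L)
  have hB := sum_caseB_slice_le hT m (L := L)
  have hpow : 0 ≤ stripYT T ^ m := pow_nonneg hyT0 _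
  have e : ∑ l ∈ (caseA T L).filter (fun l => topCnt T l = m), hexCriticalFugacity ^ l.length * stripYT T ^ m =
      (∑ l ∈ (caseA T L).filter (fun l => topCnt T l = m), hexCriticalFugacity ^ l.length) * stripYT T ^ m := by rw [sum_mul]
  rw [e] at hA
  nlinarith [mul_le_mul_of_nonneg_right hB hpow]

/-- ★★★ **THE POINTWISE THRESHOLD LAW (k = 1), every width `T ≥ 2`**: there is `C = C(T)` with `β_{T,m}(x_c) · y_T^m ≤ C` for ALL
`m`, where `β_{T,m} = stripBcoeff T m` is the `y^m`-coefficient of `B_T(x_c; ·)` — the surface-contact coefficients of the β-series of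
the honeycomb strip decay EXACTLY like `y_T^{−m}` up to a bounded factor.  Own result of the lane (renewal structure of the horizontal
bridges + sub-invariant vector at each `y < y_T` with constants uniform in `y`; no Perron–Frobenius, no renewal theorem, no automaton).
[cite: BeatonBousquetMelouDeGierDuminilCopinGuttmann2014, §3.2 and Corollary 8 (radius y_T); DuminilCopinHammond2013, §2.2;
Seneta1973, §6.2 Theorem 6.3; lane (NEXT-TARGETS)] -/
theorem stripBcoeff_mul_pow_stripYT_le (hT : 2 ≤ T) : ∃ C : ℝ, ∀ m : ℕ, stripBcoeff T m * stripYT T ^ m ≤ C := by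
  have hT1 : 1 ≤ T := by omega
  have hyT := one_lt_stripYT hT1
  have hyT0 : 0 ≤ stripYT T := by linarith
  obtain ⟨K₂, hK₂⟩ := exists_hbSlice_stripYT_le hT1
  obtain ⟨C₁, hC₁⟩ := exists_topFreeSumN_le hT1 (T := T)
  obtain ⟨C₃, hC₃⟩ := exists_botFreeSumN_le hT hyT.le (hexCriticalFugacity_mul_stripNu_pred_stripYT_lt_one hT)
  have hK₂0 : 0 ≤ K₂ := le_trans (sum_nonneg fun h _ => mul_nonneg (pow_nonneg hexCriticalFugacity_pos_lt_one.1.le _)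
    (pow_nonneg hyT0 _)) (hK₂ 0 0)
  refine ⟨2 * (C₁ * K₂ * C₃), fun m => ?_⟩
  have hpow : 0 < stripYT T ^ m := pow_pos (by linarith) _
  -- every box
  have hL : ∀ L, stripBcoeffY T L m ≤ 2 * (C₁ * K₂ * C₃) / stripYT T ^ m := by
    intro L
    rw [le_div_iff₀ hpow]
    obtain ⟨N, hN⟩ : ∃ N : ℕ, (stripV T L).card ≤ N + 1 := ⟨(stripV T L).card, by omega⟩
    refine (stripBcoeffY_mul_pow_le hT1 L m hN (hK₂ N)).trans ?_
    have h1 := hC₁ N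
    have h3 := hC₃ N
    have h10 := topFreeSumN_nonneg T N
    have h30 := (botFreeSumN_nonneg_mono T N hyT0 le_rfl).1
    have : topFreeSumN T N * K₂ * botFreeSumN T N (stripYT T) ≤ C₁ * K₂ * C₃ := by
      calc topFreeSumN T N * K₂ * botFreeSumN T N (stripYT T) ≤ C₁ * K₂ * botFreeSumN T N (stripYT T) :=
            mul_le_mul_of_nonneg_right (mul_le_mul_of_nonneg_right h1 hK₂0) h30
        _ ≤ C₁ * K₂ * C₃ := mul_le_mul_of_nonneg_left h3 (mul_nonneg (h10.trans h1) hK₂0)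
    linarith
  have hsup : stripBcoeff T m ≤ 2 * (C₁ * K₂ * C₃) / stripYT T ^ m := ciSup_le hL
  rw [← le_div_iff₀ hpow]
  exact hsup

end Final

/-! ### §5 Width one, and the pointwise threshold law for every width `T ≥ 1` -/

section WidthOne

/-- Width one, coefficientwise: `β_{1,L,m} ≤ 2 x_c^{2m}` (the β-walks of `S_{1,L}` are the two zig-zag bridges of each length `2k`,
`1 ≤ k ≤ L + 1`, with `k` contacts). [cite: BeatonBousquetMelouDeGierDuminilCopinGuttmann2014, §3.2 (proof of Proposition 5: the zig-zag walks); lane: `filter_isBetaDart_one_eq_image`] -/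
theorem stripBcoeffY_one_le (L m : ℕ) : stripBcoeffY 1 L m ≤ 2 * (hexCriticalFugacity ^ 2) ^ m := by
  classical
  have hx := hexCriticalFugacity_pos_lt_one
  set S : Finset (ℤ × ℕ) := (({1, -1} : Finset ℤ)) ×ˢ Icc 1 (L + 1) with hS
  have hinj : Set.InjOn (fun q : ℤ × ℕ => zigWalk q.1 q.2) (S.filter fun q => surfContacts 1 (zigWalk q.1 q.2) = m : Set (ℤ × ℕ)) :=
    fun q hq q' hq' h => zigWalk_injOn L (mem_filter.1 hq).1 (mem_filter.1 hq').1 h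
  have hs : ∀ q ∈ S, q.1 = 1 ∨ q.1 = -1 := fun q hq => by
    rw [hS, mem_product] at hq; simpa using hq.1
  calc stripBcoeffY 1 L m = ∑ P ∈ (S.image fun q : ℤ × ℕ => zigWalk q.1 q.2).filter (fun P => surfContacts 1 P = m),
        hexCriticalFugacity ^ mwLen P := by rw [stripBcoeffY, filter_isBetaDart_one_eq_image]
    _ = ∑ q ∈ S.filter (fun q => surfContacts 1 (zigWalk q.1 q.2) = m), hexCriticalFugacity ^ mwLen (zigWalk q.1 q.2) := by
        rw [Finset.filter_image, sum_image hinj]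
    _ = ∑ q ∈ S.filter (fun q => q.2 = m), (hexCriticalFugacity ^ 2) ^ m := by
        have hfilt : S.filter (fun q => surfContacts 1 (zigWalk q.1 q.2) = m) = S.filter (fun q => q.2 = m) :=
          filter_congr fun q hq => by rw [surfContacts_one_zigWalk (hs q hq)]
        rw [hfilt]
        refine sum_congr rfl fun q hq => ?_
        rw [mem_filter] at hq
        rw [mwLen_zigWalk, ← hq.2, pow_mul]
    _ = (S.filter fun q => q.2 = m).card * (hexCriticalFugacity ^ 2) ^ m := by rw [sum_const, nsmul_eq_mul]
    _ ≤ 2 * (hexCriticalFugacity ^ 2) ^ m := by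
        refine mul_le_mul_of_nonneg_right ?_ (pow_nonneg (pow_nonneg hx.1.le 2) m)
        have hsub : S.filter (fun q => q.2 = m) ⊆ ({((1 : ℤ), m), ((-1 : ℤ), m)} : Finset (ℤ × ℕ)) := by
          intro q hq
          rw [mem_filter] at hq
          obtain ⟨hqS, hq2⟩ := hq
          have h1 := hs q hqS
          obtain ⟨a, b⟩ := q
          simp only at hq2 h1
          subst hq2
          rcases h1 with rfl | rfl <;> simp
        calc ((S.filter fun q => q.2 = m).card : ℝ) ≤ (({((1 : ℤ), m), ((-1 : ℤ), m)} : Finset (ℤ × ℕ)).card : ℝ) := by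
              exact_mod_cast card_le_card hsub
          _ ≤ 2 := by exact_mod_cast Finset.card_le_two

/-- Width one: `β_{1,m} y_1^m ≤ 2` for all `m` (`x_c² y_1 = 1`). [cite: BeatonBousquetMelouDeGierDuminilCopinGuttmann2014, §3.2 and Corollary 8; lane: `stripYT_one`] -/
theorem stripBcoeff_one_mul_pow_le (m : ℕ) : stripBcoeff 1 m * stripYT 1 ^ m ≤ 2 := by
  have hx := hexCriticalFugacity_pos_lt_one
  have h1 := hexCriticalFugacity_sq_mul_stripYT_one
  have hyT : 0 < stripYT 1 := by linarith [one_lt_stripYT (le_refl 1)]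
  have hB : stripBcoeff 1 m ≤ 2 * (hexCriticalFugacity ^ 2) ^ m := ciSup_le fun L => stripBcoeffY_one_le L m
  calc stripBcoeff 1 m * stripYT 1 ^ m ≤ 2 * (hexCriticalFugacity ^ 2) ^ m * stripYT 1 ^ m :=
        mul_le_mul_of_nonneg_right hB (pow_nonneg hyT.le m)
    _ = 2 * (hexCriticalFugacity ^ 2 * stripYT 1) ^ m := by rw [mul_pow]; ring
    _ = 2 := by rw [h1, one_pow, mul_one]

/-- ★★★★ **The pointwise threshold law for EVERY width `T ≥ 1`**: `∃ C, ∀ m, β_{T,m}(x_c) · y_T^m ≤ C`.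
[cite: BeatonBousquetMelouDeGierDuminilCopinGuttmann2014, §3.2 and Corollary 8; DuminilCopinHammond2013, §2.2; Seneta1973, §6.2 Theorem 6.3;
lane (NEXT-TARGETS)] -/
theorem stripBcoeff_mul_pow_stripYT_le_of_one_le {T : ℕ} (hT : 1 ≤ T) : ∃ C : ℝ, ∀ m : ℕ, stripBcoeff T m * stripYT T ^ m ≤ C := by
  rcases Nat.lt_or_ge T 2 with h | h
  · obtain rfl : T = 1 := by omega
    exact ⟨2, stripBcoeff_one_mul_pow_le⟩
  · exact stripBcoeff_mul_pow_stripYT_le h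

end WidthOne

end HV

end Literature.Probability.RandomPlanarGeometry.SAW

end
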